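import Summits.Schanuel.Schanuel.Theses.DiophantineDichotomy

/-!
# `EPiSimultaneousType`: lifting a challenger of `(π, e)` to a challenger of `θ = (1, iπ, e, −1)`
(bookkeeping for the transfer `KhovanskiiApproxType → EPiSimultaneousType`; crux `stmt-Schanuel-6118`)

Integer-polynomial and field-degree bookkeeping used by
`Negative/OfKhovanskiiApproxType.lean` (route DiophantineDichotomy, cruxes 6118/6116):

* `EPiSimultaneousType.clause_I_mul` — if `γ` is a root of a non-zero `P ∈ ℤ[X]` of degree `≤ d`
  and naive height `≤ H`, then `iγ` is a root of a non-zero integer polynomial of degree `≤ 2d` and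
  height `≤ (2d+1)H²`: the TWIST `Q(x) = Σₙ χ(n) tₙ xⁿ` (`χ(n) = (−1)^{n/2}` for even `n`, `0` for
  odd `n`) of `T = Σ tₙ xⁿ := P(x)·P(−x)`, which satisfies `Q(iy) = (T(y) + T(−y))/2`.
* `EPiSimultaneousType.finrank_lift_le` — `[ℚ(1, iγ₁, γ₂, −1):ℚ] ≤ 2·[ℚ(γ₁, γ₂):ℚ]` for algebraic
  `γ₁, γ₂` (compositum with `ℚ(i)`, `[ℚ(i):ℚ] ≤ 2`).

Everything is proved; no named facts; cdisprove seat of crux 6118.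
-/

set_option linter.dupNamespace false

noncomputable section

namespace Summit.Schanuel.Schanuel.Theorems

open Polynomial Complex
open scoped IntermediateField

namespace EPiSimultaneousType

/-! ### Integer-polynomial bookkeeping for `iγ` -/

/-- Coefficients of `P(−X)`: `coeff k = (−1)^k · coeff P k`. [folklore] -/
theorem coeff_comp_neg_X (p : ℤ[X]) (k : ℕ) : (p.comp (-X)).coeff k = (-1) ^ k * p.coeff k := by
  rw [Polynomial.comp, Polynomial.eval₂_eq_sum, Polynomial.sum_def, Polynomial.finsetSum_coeff]
  have h : ∀ n, (C (p.coeff n) * (-X : ℤ[X]) ^ n).coeff k =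
      if n = k then (-1) ^ k * p.coeff k else 0 := by
    intro n
    rw [neg_pow, ← mul_assoc, show (C (p.coeff n) * (-1) ^ n : ℤ[X]) = C (p.coeff n * (-1) ^ n) by
      simp, Polynomial.coeff_C_mul_X_pow]
    by_cases hnk : n = k
    · subst hnk; simp [mul_comm]
    · simp [hnk, Ne.symm hnk]
  simp_rw [h]
  rw [Finset.sum_ite_eq']
  by_cases hk : k ∈ p.support
  · rw [if_pos hk]
  · rw [if_neg hk, Polynomial.notMem_support_iff.mp hk, mul_zero]

/-- `(P · P(−X))(y) = P(y) P(−y)`. [folklore] -/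
theorem aeval_mul_comp_neg_X (p : ℤ[X]) (y : ℂ) :
    aeval y (p * p.comp (-X)) = aeval y p * aeval (-y) p := by
  rw [map_mul, aeval_comp]
  simp

/-- Naive height of a product: `|coeff (PQ) n| ≤ (n+1) H(P) H(Q)`. [folklore] -/
theorem abs_coeff_mul_le (p q : ℤ[X]) (Hp Hq : ℤ) (hp : ∀ k, |p.coeff k| ≤ Hp)
    (hq : ∀ k, |q.coeff k| ≤ Hq) (n : ℕ) :
    |(p * q).coeff n| ≤ (n + 1) * (Hp * Hq) := by
  rw [coeff_mul]
  have h0p : 0 ≤ Hp := (abs_nonneg _).trans (hp 0)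
  refine (Finset.abs_sum_le_sum_abs _ _).trans ?_
  refine (Finset.sum_le_sum (g := fun _ => Hp * Hq) (fun x _ => ?_)).trans ?_
  · rw [abs_mul]; exact mul_le_mul (hp _) (hq _) (abs_nonneg _) h0p
  · simp [Finset.Nat.card_antidiagonal]

/-- Coefficients of the TWIST `Σₙ χ(n) tₙ Xⁿ` of `T`, `χ(n) = (−1)^{n/2}` (`n` even), `0` (`n` odd).
[folklore] -/
theorem coeff_twist (T : ℤ[X]) (k : ℕ) :
    (T.sum fun n a => monomial n ((if Even n then (-1) ^ (n / 2) else 0) * a)).coeff k =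
      (if Even k then (-1) ^ (k / 2) else 0) * T.coeff k := by
  rw [Polynomial.sum_def, Polynomial.finsetSum_coeff]
  simp_rw [Polynomial.coeff_monomial]
  rw [Finset.sum_ite_eq']
  by_cases hk : k ∈ T.support
  · rw [if_pos hk]
  · rw [if_neg hk, Polynomial.notMem_support_iff.mp hk, mul_zero]

/-- The twist does not raise the degree. [folklore] -/
theorem natDegree_twist_le (T : ℤ[X]) :
    (T.sum fun n a => monomial n ((if Even n then (-1) ^ (n / 2) else 0) * a)).natDegree ≤
      T.natDegree := by
  rw [Polynomial.natDegree_le_iff_coeff_eq_zero]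
  intro k hk
  rw [coeff_twist, Polynomial.coeff_eq_zero_of_natDegree_lt hk, mul_zero]

/-- The twist of a non-zero `T` of even degree is non-zero (its top coefficient is `±` that of `T`).
[folklore] -/
theorem twist_ne_zero {T : ℤ[X]} (hT : T ≠ 0) (he : Even T.natDegree) :
    (T.sum fun n a => monomial n ((if Even n then (-1) ^ (n / 2) else 0) * a)) ≠ 0 := by
  intro h
  have := congrArg (fun Q : ℤ[X] => Q.coeff T.natDegree) h
  simp only [coeff_twist, if_pos he, Polynomial.coeff_zero, mul_eq_zero] at this
  rcases this with h1 | h1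
  · exact (pow_ne_zero _ (by norm_num)) h1
  · exact hT (Polynomial.leadingCoeff_eq_zero.mp h1)

/-- `χ(n) (iy)ⁿ = (yⁿ + (−y)ⁿ)/2`. [folklore] -/
theorem chi_mul_I_mul_pow (y : ℂ) (n : ℕ) :
    (((if Even n then (-1) ^ (n / 2) else 0 : ℤ)) : ℂ) * (I * y) ^ n = (y ^ n + (-y) ^ n) / 2 := by
  rcases Nat.even_or_odd n with ⟨m, rfl⟩ | ⟨m, rfl⟩
  · have hm : (m + m) / 2 = m := by omega
    rw [if_pos ⟨m, rfl⟩, hm, ← two_mul]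
    push_cast
    rw [pow_mul, pow_mul, pow_mul, mul_pow, Complex.I_sq, neg_sq, mul_pow]
    have h1 : ((-1 : ℂ)) ^ m * (-1) ^ m = 1 := by rw [← mul_pow]; simp
    linear_combination (y ^ 2) ^ m * h1
  · have hodd : ¬ Even (2 * m + 1) := Nat.not_even_iff_odd.mpr ⟨m, rfl⟩
    rw [if_neg hodd]
    push_cast
    rw [zero_mul, neg_pow, Odd.neg_one_pow ⟨m, rfl⟩]
    ring

/-- The twist `Q` of `T` satisfies `Q(iy) = (T(y) + T(−y))/2`. [folklore] -/
theorem aeval_twist_I_mul (T : ℤ[X]) (y : ℂ) :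
    aeval (I * y) (T.sum fun n a => monomial n ((if Even n then (-1) ^ (n / 2) else 0) * a)) =
      (aeval y T + aeval (-y) T) / 2 := by
  set Q := T.sum fun n a => monomial n ((if Even n then (-1) ^ (n / 2) else 0) * a) with hQ
  have hQdeg : Q.natDegree < T.natDegree + 1 := Nat.lt_succ_of_le (natDegree_twist_le T)
  have hTdeg : T.natDegree < T.natDegree + 1 := Nat.lt_succ_self _
  rw [Polynomial.aeval_eq_sum_range' hQdeg, Polynomial.aeval_eq_sum_range' hTdeg,
    Polynomial.aeval_eq_sum_range' hTdeg, ← Finset.sum_add_distrib, Finset.sum_div]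
  refine Finset.sum_congr rfl fun n _ => ?_
  rw [hQ, coeff_twist]
  simp only [zsmul_eq_mul, Int.cast_mul]
  rw [mul_assoc, mul_left_comm, chi_mul_I_mul_pow]
  ring

/-- THE CLAUSE FOR `iγ`: if `γ` is a root of a non-zero `P ∈ ℤ[X]` of degree `≤ d` and height
`≤ H`, then `iγ` is a root of a non-zero integer polynomial of degree `≤ 2d` and height
`≤ (2d+1)H²` (the twist of `P(x)P(−x)`). [folklore] -/
theorem clause_I_mul {γ : ℂ} {d H : ℕ}
    (h : ∃ P : Polynomial ℤ, P ≠ 0 ∧ P.natDegree ≤ d ∧ (∀ k, |P.coeff k| ≤ (H : ℤ)) ∧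
      Polynomial.aeval γ P = 0) :
    ∃ Q : Polynomial ℤ, Q ≠ 0 ∧ Q.natDegree ≤ 2 * d ∧
      (∀ k, |Q.coeff k| ≤ (((2 * d + 1) * H ^ 2 : ℕ) : ℤ)) ∧ Polynomial.aeval (I * γ) Q = 0 := by
  obtain ⟨P, hP0, hdeg, hH, hroot⟩ := h
  set T : ℤ[X] := P * P.comp (-X) with hT
  have hc0 : P.comp (-X) ≠ 0 := fun h0 => hP0 (comp_neg_X_eq_zero_iff.mp h0)
  have hT0 : T ≠ 0 := mul_ne_zero hP0 hc0
  have hdegc : (P.comp (-X)).natDegree = P.natDegree :=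
    Polynomial.natDegree_eq_of_degree_eq degree_comp_neg_X
  have hdegT : T.natDegree = 2 * P.natDegree := by
    rw [hT, Polynomial.natDegree_mul hP0 hc0, hdegc]; ring
  have heven : Even T.natDegree := ⟨P.natDegree, by rw [hdegT]; ring⟩
  refine ⟨T.sum fun n a => monomial n ((if Even n then (-1) ^ (n / 2) else 0) * a),
    twist_ne_zero hT0 heven, (natDegree_twist_le T).trans (by rw [hdegT]; omega), ?_, ?_⟩
  · intro k
    rw [coeff_twist]
    have hTk : |T.coeff k| ≤ (((2 * d + 1) * H ^ 2 : ℕ) : ℤ) := by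
      by_cases hk : k ≤ 2 * d
      · have h1 := abs_coeff_mul_le P (P.comp (-X)) H H hH
          (fun j => by rw [coeff_comp_neg_X, abs_mul, abs_pow, abs_neg, abs_one, one_pow, one_mul]
                       exact hH j) k
        refine h1.trans ?_
        have hH0 : (0 : ℤ) ≤ H := by positivity
        push_cast
        have : ((k : ℤ) + 1) ≤ 2 * d + 1 := by omega
        nlinarith
      · have : T.coeff k = 0 := Polynomial.coeff_eq_zero_of_natDegree_lt (by rw [hdegT]; omega)
        rw [this, abs_zero]; positivity
    refine le_trans ?_ hTk
    rw [abs_mul]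
    refine mul_le_of_le_one_left (abs_nonneg _) ?_
    split_ifs <;> simp
  · rw [aeval_twist_I_mul, hT, aeval_mul_comp_neg_X, aeval_mul_comp_neg_X, neg_neg, hroot]
    simp

/-! ### Degrees -/

/-- The admissibility clause forces `d ≥ 1` and `H ≥ 1`. [folklore] -/
theorem one_le_of_clause' {d H : ℕ} {z : ℂ}
    (h : ∃ P : Polynomial ℤ, P ≠ 0 ∧ P.natDegree ≤ d ∧ (∀ k, |P.coeff k| ≤ (H : ℤ)) ∧
      Polynomial.aeval z P = 0) : 1 ≤ d ∧ 1 ≤ H := by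
  obtain ⟨P, hP0, hdeg, hH, hroot⟩ := h
  constructor
  · by_contra hd
    have hd0 : P.natDegree = 0 := by omega
    rw [Polynomial.eq_C_of_natDegree_eq_zero hd0] at hroot
    simp at hroot
    apply hP0
    rw [Polynomial.eq_C_of_natDegree_eq_zero hd0, hroot, map_zero]
  · by_contra hH0
    have : H = 0 := by omega
    subst this
    apply hP0
    ext k
    have := hH k
    simp only [CharP.cast_eq_zero, abs_nonpos_iff] at this
    simp [this]

/-- A coordinate satisfying the clause is integral over `ℚ`. [folklore] -/
theorem isIntegral_of_clause {d H : ℕ} {z : ℂ}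
    (h : ∃ P : Polynomial ℤ, P ≠ 0 ∧ P.natDegree ≤ d ∧ (∀ k, |P.coeff k| ≤ (H : ℤ)) ∧
      Polynomial.aeval z P = 0) : IsIntegral ℚ z := by
  obtain ⟨P, hP0, -, -, hroot⟩ := h
  refine (isAlgebraic_iff_isIntegral.mp ⟨P.map (algebraMap ℤ ℚ), ?_, ?_⟩)
  · exact (Polynomial.map_ne_zero_iff (algebraMap ℤ ℚ).injective_int).mpr hP0
  · rw [Polynomial.aeval_map_algebraMap]; exact hroot

/-- `i` is integral over `ℚ` (`X² + 1`). [folklore] -/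
theorem isIntegral_I : IsIntegral ℚ I := by
  refine ⟨X ^ 2 + 1, Polynomial.monic_X_pow_add_C 1 (by norm_num), ?_⟩
  simp

/-- `[ℚ(i):ℚ] ≤ 2`. [folklore] -/
theorem finrank_adjoin_I_le : Module.finrank ℚ ↥ℚ⟮I⟯ ≤ 2 := by
  rw [IntermediateField.adjoin.finrank isIntegral_I]
  have h := minpoly.degree_le_of_ne_zero ℚ I (p := X ^ 2 + 1)
    (Polynomial.X_pow_add_C_ne_zero (by norm_num) 1) (by simp)
  calc (minpoly ℚ I).natDegree ≤ (X ^ 2 + 1 : ℚ[X]).natDegree := Polynomial.natDegree_le_natDegree h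
    _ = 2 := by
      simpa using Polynomial.natDegree_X_pow_add_C (n := 2) (r := (1 : ℚ))

/-- FIELD DEGREE OF THE LIFT: `[ℚ(1, iγ₁, γ₂, −1):ℚ] ≤ 2·[ℚ(γ₁, γ₂):ℚ]` when `γ₁, γ₂` are algebraic.
[folklore] -/
theorem finrank_lift_le (γ : Fin 2 → ℂ) (hint : ∀ i, IsIntegral ℚ (γ i)) :
    Module.finrank ℚ ↥(IntermediateField.adjoin ℚ
        (Set.range (Sum.elim ![(1 : ℂ), I * γ 0] ![γ 1, -1] : Fin 2 ⊕ Fin 2 → ℂ))) ≤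
      2 * Module.finrank ℚ ↥(IntermediateField.adjoin ℚ (Set.range γ)) := by
  set K1 := IntermediateField.adjoin ℚ (Set.range γ) with hK1
  set K2 : IntermediateField ℚ ℂ := ℚ⟮I⟯ with hK2
  haveI : Finite (Set.range γ) := Set.finite_range γ |>.to_subtype
  haveI : FiniteDimensional ℚ K1 :=
    IntermediateField.finiteDimensional_adjoin (fun x hx => by
      obtain ⟨i, rfl⟩ := hx; exact hint i)
  haveI : FiniteDimensional ℚ K2 := IntermediateField.adjoin.finiteDimensional isIntegral_I
  have hle : IntermediateField.adjoin ℚ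
      (Set.range (Sum.elim ![(1 : ℂ), I * γ 0] ![γ 1, -1] : Fin 2 ⊕ Fin 2 → ℂ)) ≤ K1 ⊔ K2 := by
    rw [IntermediateField.adjoin_le_iff]
    rintro _ ⟨i, rfl⟩
    have hγ : ∀ j, γ j ∈ K1 ⊔ K2 := fun j =>
      (le_sup_left : K1 ≤ K1 ⊔ K2) (IntermediateField.subset_adjoin ℚ _ ⟨j, rfl⟩)
    have hI : I ∈ K1 ⊔ K2 :=
      (le_sup_right : K2 ≤ K1 ⊔ K2) (IntermediateField.mem_adjoin_simple_self ℚ I)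
    rcases i with i | i <;> fin_cases i
    · exact one_mem _
    · exact mul_mem hI (hγ 0)
    · exact hγ 1
    · exact neg_mem (one_mem _)
  calc Module.finrank ℚ ↥(IntermediateField.adjoin ℚ
          (Set.range (Sum.elim ![(1 : ℂ), I * γ 0] ![γ 1, -1] : Fin 2 ⊕ Fin 2 → ℂ)))
      ≤ Module.finrank ℚ ↥(K1 ⊔ K2) := IntermediateField.finrank_le_of_le_right hle
    _ ≤ Module.finrank ℚ K1 * Module.finrank ℚ K2 := IntermediateField.finrank_sup_le K1 K2
    _ ≤ Module.finrank ℚ K1 * 2 := Nat.mul_le_mul_left _ finrank_adjoin_I_le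
    _ = 2 * Module.finrank ℚ K1 := by ring

end EPiSimultaneousType

end Summit.Schanuel.Schanuel.Theorems

end
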